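import Literature.MathematicalPhysics.QuantumFieldTheory.Balaban1983to89.Node00.CarriersB8CubeSub
import Literature.MathematicalPhysics.QuantumFieldTheory.Balaban1983to89.B8IdxB8LawsB

/-!
# NODE 00 (YM-PLAN Track A) — STAGE 3′(X.B8″): THE [Balaban1985RegularSpaces] SUB-FAMILY PIN WITH THE BOND-SET LAW — the [B8] group of record RE-KEYED over
# n05-c's four-law sub-index `IdxB8SubB θ` (`B8IdxB8LawsB`: g32's three located index laws №7 ∕ №8 ∕ №11 + №12 «`Λb` = the bond class the Λ-tower
# generates», (1.12) p. 78 with the bond convention of p. 77), the surviving leaf over that sub-family (`B8LeafOfRecordSubB`), OLD ⇒ NEW from g31's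
# full-family leaf and from g32's three-law leaf, and the reading of the slot at the CUT residual layer the N05 knits of record conclude

[Balaban1985RegularSpaces] = T. Bałaban, *Spaces of regular gauge field configurations on a lattice and gauge fixing conditions*, Commun. Math. Phys. **99**
(1985) 75–102 — Lemma 1 p. 79, Thm 2 p. 83, Prop. 3 p. 87, Thm 4 p. 88, Props. 5–7 pp. 94–100, Thm 8 p. 101; the admitted families p. 77 («we admit Ω_j = T_η»,
(1.3)–(1.6)), the bonds of the tower (1.12) p. 78 ∕ (1.31) p. 82.  PDF held: `paper:balaban1985-cmp99-regular-spaces-gauge-fixing` (journal page = PDF page + 74).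

WHAT THIS MODULE IS (seat `pub-ymgap-dag-n05-d` g4, 2026-08-27, TAKING node00-def g33's OPEN OFFER of 2026-08-26T20:31Z as the consumer; APPEND-ONLY: a NEW importing
module — g31's `Node00/CarriersB8`, g32's `Node00/CarriersB8Sub`, def-cube's `Node00/CarriersB8Cube(Sub)` and n05-c's `B8IdxB8LawsB` are untouched and CONSUMED BY NAME).
WHY.  Referee flag J2′ (ref-A g12, kernel `sb9all_false`; n05-c g2 `B8IdxB8LawsB.exists_idxB8Sub_not_lawsB`): the b9-socket binder `∀ i, ∀ m ≤ i.k, SockB9P3 … (i.Λb m)` of every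
[B8] knit of record is REFUTED at members of g32's three-law sub-index `IdxB8Sub θ` whose bond classes are empty (legal there: №7∕№8∕№11 do not read `Λb`), so the record's
slot `B8LeafOfRecordSub θ λ` (g32; the [B8′] pin of `Node00/Record12Carriers`) cannot be closed by any knit keyed on that socket; the knits of record therefore range over the
FOUR-law sub-index `IdxB8SubB θ` (`pub-ymgap-dag-n05-d` g2 p468932 `exists_c₁_b8LeafRS_subB_cut_of_knit_lettersRDU`, g3 p482097 §3 `b8LeafRS_subB_of_knit_lettersRDUB`,
n05-c g3 + n05-d g3 p482401 `exists_c₁_b8LeafRS_subB_cut_zdLan_of_knit_lettersRDUB`), on which the empty-bond witnesses are EXCLUDED (`B8IdxB8LawsB.not_idxB8LawsB_of_bonds_empty`)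
and which is inhabited by genuine members at every depth (`B8IdxB8LawsB.nonempty_idxB8SubB_depth`).  THIS FILE types the carrier side of that pin:

* §1 **`PrintedCarriersR.withB8OfRecordSubB X θ λ`** — g32's `withB8OfRecordSub` VERBATIM with `IdxB8Sub ↦ IdxB8SubB` (index `I8b := IdxB8SubB θ`; family, R-extension
  and Proposition 7's axial map read through `Subtype.val`; SAME residual layer `λ : ResidB8 θ`); **`B8LeafOfRecordSubB θ λ`** — the surviving leaf `B8LeafRS` over
  `fun j : IdxB8SubB θ => famB8OfRecordSubB θ λ.β λ.len j` with `λ.lan`, `λ.cub`, `fun j => λ.toAxial j.1` = LETTER FOR LETTER the conclusion shape of the knits of record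
  (p482097 §3 proves `B8LeafOfRecordSubB θ λ` by `exact`); `b8LeafRS_withB8OfRecordSubB_iff` (`Iff.rfl`); the five `rfl` commuting faces with the other carrier groups.
* §2 OLD ⇒ NEW (never conversely): `b8LeafOfRecordSubB_of_b8LeafOfRecord` (g31's `b8LeafOfRecord_subtype` at the predicate `IdxB8LawsB`) and
  `b8LeafOfRecordSubB_of_b8LeafOfRecordSub` (from g32's three-law leaf along `IdxB8SubB.toSub`, conjunct by conjunct through n05-a's `…_precomp` lemmas);
  `C136_C162_famB8OfRecordSubB` (the carrier law (1.36) ⊂ (1.62) under which the typed leaf implies the surviving one, g31's BY NAME).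
* §3 THE CUT LAYER: **`ResidB8.cutSubB λ J lan c₁`** := `{λ.withCubOn (IdxB8LawsB θ.L ·.1) with I8c := J, lan := lan, c₁ := c₁}` — the residual layer whose Prop.-6
  slot is cut to the law members (def-cube's `withCubOn`, `cub := cubB8OfRecord θ ·.1`), whose Prop.-5 slot is RE-POINTED to a named family `lan : J → B8.LandauData`
  (e.g. lit-type-B8's `zdLan θ.L λ.B₁ ∘ ι`) and whose threshold is a named `c₁` (print's «there exists c₁»); `rfl` field faces; **`b8LeafOfRecordSubB_cutSubB_iff`**
  (`Iff.rfl`): the slot at the cut layer READS `B8LeafRS … (famB8OfRecordSubB θ λ.β λ.len ·) lan (fun j : IdxB8SubB θ => cubB8OfRecord θ j.1) (fun j => λ.toAxial j.1)` with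
  threshold `c₁` — the conclusion of p468932 ∕ p482401 letter for letter, so those knits close the slot at `λ.cutSubB …` by `exact`.

HONEST FRAMING: DEFINITIONS and `rfl` bookkeeping only — nothing of [Balaban1985RegularSpaces] is asserted or discharged here; whether the knits' sockets and letters are
satisfiable over `IdxB8SubB` is the suppliers' theorem (N06 lineage), not claimed; N05 NOT discharged; counts unmoved; one finite T⁴ programme at fixed ε, Bałaban as printed
— NOT continuum ∕ ℝ⁴ ∕ infinite volume ∕ OS ∕ mass gap ∕ Clay.  No `sorry`, no `axiom`, no `opaque`, no `instance`, no `notation`. -/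

noncomputable section

namespace Literature.MathematicalPhysics.QuantumFieldTheory.Balaban1983to89.Node00

open DagBinding
open B8LeafKnitRS (B8LeafRS)
open B8LeafModelZd (ZdIdx)
open B8Lemma1NonAbelian (blockPairNA)
open B8IdxB8LawsB (IdxB8LawsB IdxB8SubB famB8OfRecordSubB)

/-! ## §1. The [B8] group of record re-keyed over the four-law sub-index; the surviving leaf over it -/

section SubIndexB

variable {θ : Stage3Params}

/-- **THE [B8] GROUP OF RECORD RE-KEYED OVER THE FOUR-LAW SUB-INDEX, substituted into a carrier bundle**: g32's `withB8OfRecordSub` with `I8b := IdxB8SubB θ`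
(n05-c's `B8IdxB8LawsB.IdxB8SubB`: `Ω₀ = T_η` + the located laws №7 ∕ №8 ∕ №11 + the bond-set law №12), the family, its R-extension and Proposition 7's axial map read
through `Subtype.val` (SAME residual layer `lam : ResidB8 θ`); every other group of `X` unchanged.
[cite: Balaban1985RegularSpaces, Lemma 1 p.79 – Thm 8 p.101 (the carriers of the typed statements); (1.12) p.78, p.77 (bond convention)] -/
def _root_.Literature.MathematicalPhysics.QuantumFieldTheory.Balaban1983to89.DagBinding.PrintedCarriersR.withB8OfRecordSubB (X : PrintedCarriersR)
    (θ : Stage3Params) (lam : ResidB8 θ) : PrintedCarriersR :=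
  { X with
    I8a := B7Prop1Explicit.Site θ.D × Fin θ.D, I8b := IdxB8SubB θ, I8c := lam.I8c, I8d := lam.I8d, d8 := θ.D, L8 := θ.L,
    C₂ := lam.C₂, B₁' := lam.B₁', B₀' := lam.inp.B₀', B₁ := lam.B₁, B₂ := lam.B₂, c₁ := lam.c₁, inp8 := lam.inp, B₀β := lam.B₀β,
    loc8 := blockPairNA θ.D θ.L θ.𝔸, fam8 := fun i => (famB8OfRecordSubB θ lam.β lam.len i).toGFData2, lan8 := lam.lan, cub8 := lam.cub,
    toAxial8 := fun i => lam.toAxial i.1,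
    C140 := fun i => (famB8OfRecordSubB θ lam.β lam.len i).C140, InR := fun i => (famB8OfRecordSubB θ lam.β lam.len i).InR,
    proj140 := fun i α₂ U₀ U₁ h => proj140_famB8OfRecord lam.β lam.len i.1 α₂ U₀ U₁ h }

/-- **THE `b8` LEAF AT THE RE-KEYED GROUP OF RECORD, IN ITS SURVIVING FORM, OVER THE FOUR-LAW SUB-FAMILY** (Lemma 1 p. 79, Thm 2 p. 83, Prop. 3 p. 87, Thm 4 p. 88,
Prop. 5 p. 94, Prop. 6 p. 99, Prop. 7 p. 100 faithful, Thm 8 p. 101 surviving at γ = 1) — letter for letter the conclusion shape of the knits of record over `IdxB8SubB θ`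
(`BalabanUVNodesN05SubBKnit.b8LeafRS_subB_of_knit_lettersRDUB`).
[cite: Balaban1985RegularSpaces, Lemma 1 p.79, Thm 2 p.83, Prop. 3 p.87, Thm 4 p.88, Prop. 5 p.94, Prop. 6 p.99, Prop. 7 p.100, Thm 8 p.101 (surviving form, GAPS G-B8-13)] -/
def B8LeafOfRecordSubB (θ : Stage3Params) (lam : ResidB8 θ) : Prop :=
  B8LeafRS θ.D (θ.L : ℝ) lam.C₂ lam.B₁' lam.inp.B₀' lam.B₁ lam.B₂ lam.c₁ lam.inp lam.B₀β (blockPairNA θ.D θ.L θ.𝔸)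
    (fun j : IdxB8SubB θ => famB8OfRecordSubB θ lam.β lam.len j) lam.lan lam.cub (fun j => lam.toAxial j.1)

/-- The surviving leaf over the SUBSTITUTED bundle's own [B8] group IS `B8LeafOfRecordSubB θ lam` (`Iff.rfl`). [cite: Balaban1985RegularSpaces, Lemma 1 – Thm 8 pp.79–101 (bookkeeping)] -/
theorem b8LeafRS_withB8OfRecordSubB_iff (X : PrintedCarriersR) (θ : Stage3Params) (lam : ResidB8 θ) :
    B8LeafRS (X.withB8OfRecordSubB θ lam).d8 (X.withB8OfRecordSubB θ lam).L8 (X.withB8OfRecordSubB θ lam).C₂ (X.withB8OfRecordSubB θ lam).B₁'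
        (X.withB8OfRecordSubB θ lam).B₀' (X.withB8OfRecordSubB θ lam).B₁ (X.withB8OfRecordSubB θ lam).B₂ (X.withB8OfRecordSubB θ lam).c₁ (X.withB8OfRecordSubB θ lam).inp8
        (X.withB8OfRecordSubB θ lam).B₀β (X.withB8OfRecordSubB θ lam).loc8 (X.withB8OfRecordSubB θ lam).fam8R (X.withB8OfRecordSubB θ lam).lan8
        (X.withB8OfRecordSubB θ lam).cub8 (X.withB8OfRecordSubB θ lam).toAxial8 ↔
      B8LeafOfRecordSubB θ lam :=
  Iff.rfl

/-- The leaf over the four-law sub-family, unfolded to the family of record through `Subtype.val` (`Iff.rfl`: `famB8OfRecordSubB θ β len j = famB8OfRecord θ β len j.1`).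
[cite: Balaban1985RegularSpaces, Lemma 1 – Thm 8 pp.79–101 (bookkeeping)] -/
theorem b8LeafOfRecordSubB_iff (lam : ResidB8 θ) :
    B8LeafOfRecordSubB θ lam ↔
      B8LeafRS θ.D (θ.L : ℝ) lam.C₂ lam.B₁' lam.inp.B₀' lam.B₁ lam.B₂ lam.c₁ lam.inp lam.B₀β (blockPairNA θ.D θ.L θ.𝔸)
        (fun j : IdxB8SubB θ => famB8OfRecord θ lam.β lam.len j.1) lam.lan lam.cub (fun j => lam.toAxial j.1) :=
  Iff.rfl

/-- The substitution does not touch the [B10] group (`rfl`) … [cite: Balaban1985UV3, (1)–(5) p.256 (bookkeeping)] -/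
theorem withB8OfRecordSubB_runs10 (X : PrintedCarriersR) (θ : Stage3Params) (lam : ResidB8 θ) : (X.withB8OfRecordSubB θ lam).runs10 = X.runs10 := rfl

/-- … nor the [B12 §§2–5] group (`rfl` ×2) … [cite: Balaban1987RG1, Lemma 4 p.280 (bookkeeping)] -/
theorem withB8OfRecordSubB_F12_c12 (X : PrintedCarriersR) (θ : Stage3Params) (lam : ResidB8 θ) :
    (X.withB8OfRecordSubB θ lam).F12 = X.F12 ∧ (X.withB8OfRecordSubB θ lam).c12 = X.c12 := ⟨rfl, rfl⟩

/-- … commutes with the [B10] re-binding `withRuns10` (`rfl`) … [cite: Balaban1985UV3, (1)–(5) p.256 (bookkeeping)] -/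
theorem withRuns10_withB8OfRecordSubB (X : PrintedCarriersR) {J : Type} (r : J → B10.RunData) (θ : Stage3Params) (lam : ResidB8 θ) :
    (X.withRuns10 r).withB8OfRecordSubB θ lam = (X.withB8OfRecordSubB θ lam).withRuns10 r := rfl

/-- … with the [B12] substitution `withB12` (`rfl`) … [cite: Balaban1987RG1, Lemma 4 p.280 (bookkeeping)] -/
theorem withB12_withB8OfRecordSubB (X : PrintedCarriersR) (F12 : B12Sec2to5.Lemma4Frame) (c12 : B12Sec2to5.Lemma4Consts) (θ : Stage3Params) (lam : ResidB8 θ) :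
    (X.withB12 F12 c12).withB8OfRecordSubB θ lam = (X.withB8OfRecordSubB θ lam).withB12 F12 c12 := rfl

/-- … and passes through the Stage-3 substitutions `carriers₃` (`rfl`). [cite: Balaban1984PropagatorsII, pp.223–250 (bookkeeping)] -/
theorem carriers₃_withB8OfRecordSubB (θ₃ : Stage3Params) (X : PrintedCarriersR) (θ : Stage3Params) (lam : ResidB8 θ) :
    carriers₃ θ₃ (X.withB8OfRecordSubB θ lam) = (carriers₃ θ₃ X).withB8OfRecordSubB θ lam := rfl

/-- The four-law re-keying REFINES the three-law one at the index: the same datum through `IdxB8SubB.toSub` (`rfl`). [cite: Balaban1985RegularSpaces, p.77 (bookkeeping)] -/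
theorem famB8OfRecordSubB_eq_famB8OfRecordSub_toSub (β : ℝ) (len : B7Prop1Explicit.Site θ.D → ℝ) (j : IdxB8SubB θ) :
    famB8OfRecordSubB θ β len j = famB8OfRecordSub θ β len (IdxB8SubB.toSub j) := rfl

/-! ## §2. OLD ⇒ NEW (never conversely) and the carrier law on the four-law sub-family -/

/-- **OLD ⇒ NEW from the FULL-FAMILY leaf of record** — g31's `b8LeafOfRecord_subtype` at the predicate `IdxB8LawsB θ.L ·.1` BY NAME; never conversely.
[cite: Balaban1985RegularSpaces, Lemma 1 – Thm 8 pp.79–101 (bookkeeping: restriction of the family index)] -/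
theorem b8LeafOfRecordSubB_of_b8LeafOfRecord (lam : ResidB8 θ) (h : B8LeafOfRecord θ lam) : B8LeafOfRecordSubB θ lam :=
  b8LeafOfRecord_subtype (fun i : IdxB8 θ => IdxB8LawsB θ.L i.1) lam h

/-- **OLD ⇒ NEW from g32's THREE-LAW leaf** — conjunct by conjunct along `IdxB8SubB.toSub` (n05-a's `…_precomp` lemmas and `B8Thm8Surviving.thm8SurvivingAt_precomp` BY NAME;
`l1`, `p5e`, `p5u`, `p6` do not read the gauge-fixing family); never conversely. [cite: Balaban1985RegularSpaces, Lemma 1 – Thm 8 pp.79–101 (bookkeeping: restriction of the family index)] -/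
theorem b8LeafOfRecordSubB_of_b8LeafOfRecordSub (lam : ResidB8 θ) (h : B8LeafOfRecordSub θ lam) : B8LeafOfRecordSubB θ lam where
  l1 := h.l1
  t2 := B8LeafKnit.thm2Printed_precomp IdxB8SubB.toSub (fun i : IdxB8Sub θ => (famB8OfRecord θ lam.β lam.len i.1).toGFData) h.t2
  p3 := B8LeafKnit.prop3Printed_precomp IdxB8SubB.toSub θ.D (θ.L : ℝ) lam.C₂ lam.inp lam.B₀β (fun i : IdxB8Sub θ => (famB8OfRecord θ lam.β lam.len i.1).toGFData2) h.p3
  t4 := B8LeafKnit.thm4Printed_precomp IdxB8SubB.toSub lam.B₁' (fun i : IdxB8Sub θ => (famB8OfRecord θ lam.β lam.len i.1).toGFData) h.t4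
  p5e := h.p5e
  p5u := h.p5u
  p6 := h.p6
  p7 := B8LeafKnit.prop7PrintedR_precomp IdxB8SubB.toSub (fun i : IdxB8Sub θ => famB8OfRecord θ lam.β lam.len i.1) (fun i => lam.toAxial i.1) h.p7
  t8 := B8Thm8Surviving.thm8SurvivingAt_precomp IdxB8SubB.toSub 1 lam.B₁ lam.B₂ (fun i : IdxB8Sub θ => famB8OfRecord θ lam.β lam.len i.1) h.t8

/-- **THE CARRIER LAW (1.36) ⊂ (1.62) HOLDS ON THE FOUR-LAW SUB-FAMILY** (g31's `C136_C162_famB8OfRecord` at `i.1`; the law under which the typed leaf implies the surviving one).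
[cite: Balaban1985RegularSpaces, (1.36) p.82, (1.62) p.87] -/
theorem C136_C162_famB8OfRecordSubB (β : ℝ) (len : B7Prop1Explicit.Site θ.D → ℝ) (i : IdxB8SubB θ) (b b₂ s : ℝ) (U₀ : (famB8OfRecordSubB θ β len i).Cfg)
    (U₁ : (famB8OfRecordSubB θ β len i).Pert) (h : (famB8OfRecordSubB θ β len i).C136 b b₂ s U₀ U₁) : (famB8OfRecordSubB θ β len i).C162 b s U₀ U₁ :=
  C136_C162_famB8OfRecord β len i.1 b b₂ s U₀ U₁ h

/-- **TYPED ⇒ SURVIVING over the four-law sub-family** (`B8LeafKnitRS.b8LeafRS_of_b8LeafR` under `C136_C162_famB8OfRecordSubB`): the leaf AS TYPED (`DagBinding.B8LeafR`, `t8 :=`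
Thm 8 printed at γ = 1) over the re-keyed group implies `B8LeafOfRecordSubB`; never conversely. [cite: Balaban1985RegularSpaces, Thm 8 p.101 + (1.36) p.82 + (1.62) p.87 (bookkeeping)] -/
theorem b8LeafOfRecordSubB_of_b8LeafR (lam : ResidB8 θ)
    (h : B8LeafR θ.D (θ.L : ℝ) lam.C₂ lam.B₁' lam.inp.B₀' lam.B₁ lam.B₂ lam.c₁ lam.inp lam.B₀β (blockPairNA θ.D θ.L θ.𝔸)
      (fun j : IdxB8SubB θ => famB8OfRecordSubB θ lam.β lam.len j) lam.lan lam.cub (fun j => lam.toAxial j.1)) :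
    B8LeafOfRecordSubB θ lam :=
  B8LeafKnitRS.b8LeafRS_of_b8LeafR (C136_C162_famB8OfRecordSubB lam.β lam.len) h

/-- Non-vacuity of the pin's index (n05-c's `B8IdxB8LawsB.nonempty_idxB8SubB` BY NAME: genuine `Ω_j = ℤᵈ` members at every depth). [cite: Balaban1985RegularSpaces, p.77 («we admit Ω_j = T_η»)] -/
theorem nonempty_I8b_withB8OfRecordSubB (X : PrintedCarriersR) (θ : Stage3Params) (lam : ResidB8 θ) : Nonempty (X.withB8OfRecordSubB θ lam).I8b :=
  B8IdxB8LawsB.nonempty_idxB8SubB θ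

end SubIndexB

/-! ## §3. The CUT residual layer the knits of record conclude at: Prop.-6 slot cut to the law members, Prop.-5 slot re-pointed, threshold named -/

section CutLayer

variable {θ : Stage3Params}

/-- **THE CUT RESIDUAL LAYER**: `λ.cutSubB J lan c₁` := def-cube's `λ.withCubOn (IdxB8LawsB θ.L ·.1)` (Proposition 6's slot located over the law members, `cub := cubB8OfRecord θ ·.1`)
with Proposition 5's carriers RE-POINTED to a named family `lan : J → B8.LandauData` and the threshold `c₁` named (print's «there exist constants … c₁»); Hölder data, axial map,
[B9] inputs and the other constants unchanged. [cite: Balaban1985RegularSpaces, Thm 2 p.83 («There exist constants B₁, B₂(β₀), c₁»), Prop. 5 p.94, Prop. 6 p.99 (objects of record)] -/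
def ResidB8.cutSubB (lam : ResidB8 θ) (J : Type) (lan : J → B8.LandauData) (c₁ : ℝ) : ResidB8 θ :=
  { lam.withCubOn (fun i : IdxB8 θ => IdxB8LawsB θ.L i.1) with I8c := J, lan := lan, c₁ := c₁ }

/-- Field faces of the cut layer (`rfl` ×6): Prop.-5 index and members, Prop.-6 index and members, threshold, axial map.
[cite: Balaban1985RegularSpaces, Prop. 5 p.94, Prop. 6 p.99, Thm 2 p.83 (bookkeeping)] -/
theorem ResidB8.cutSubB_fields (lam : ResidB8 θ) (J : Type) (lan : J → B8.LandauData) (c₁ : ℝ) :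
    (lam.cutSubB J lan c₁).I8c = J ∧ (lam.cutSubB J lan c₁).lan = lan ∧ (lam.cutSubB J lan c₁).I8d = IdxB8SubB θ ∧
      (lam.cutSubB J lan c₁).cub = (fun i : IdxB8SubB θ => cubB8OfRecord θ i.1) ∧ (lam.cutSubB J lan c₁).c₁ = c₁ ∧
      (lam.cutSubB J lan c₁).toAxial = lam.toAxial :=
  ⟨rfl, rfl, rfl, rfl, rfl, rfl⟩

/-- The cut layer keeps the Hölder data, the [B9] inputs and the shared constants (`rfl` ×8). [cite: Balaban1985RegularSpaces, Thm 2 p.83 (bookkeeping)] -/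
theorem ResidB8.cutSubB_consts (lam : ResidB8 θ) (J : Type) (lan : J → B8.LandauData) (c₁ : ℝ) :
    (lam.cutSubB J lan c₁).β = lam.β ∧ (lam.cutSubB J lan c₁).len = lam.len ∧ (lam.cutSubB J lan c₁).inp = lam.inp ∧ (lam.cutSubB J lan c₁).C₂ = lam.C₂ ∧
      (lam.cutSubB J lan c₁).B₁' = lam.B₁' ∧ (lam.cutSubB J lan c₁).B₁ = lam.B₁ ∧ (lam.cutSubB J lan c₁).B₂ = lam.B₂ ∧ (lam.cutSubB J lan c₁).B₀β = lam.B₀β :=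
  ⟨rfl, rfl, rfl, rfl, rfl, rfl, rfl, rfl⟩

/-- The cut layer IS def-cube's located Prop.-6 slot with two further fields re-pointed (`rfl`): its `withCubOn` face is itself.
[cite: Balaban1985RegularSpaces, Prop. 6 p.99 (bookkeeping)] -/
theorem ResidB8.cutSubB_withCubOn (lam : ResidB8 θ) (J : Type) (lan : J → B8.LandauData) (c₁ : ℝ) :
    (lam.cutSubB J lan c₁).withCubOn (fun i : IdxB8 θ => IdxB8LawsB θ.L i.1) = lam.cutSubB J lan c₁ := rfl

/-- **THE SLOT AT THE CUT LAYER READS THE KNITS' CONCLUSION LETTER FOR LETTER** (`Iff.rfl`): `B8LeafOfRecordSubB θ (λ.cutSubB J lan c₁)` is the surviving leaf over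
`famB8OfRecordSubB θ λ.β λ.len`, Prop. 5 at `lan`, Prop. 6 at `fun j : IdxB8SubB θ => cubB8OfRecord θ j.1`, the axial map through `·.1`, threshold `c₁` — the conclusion of
`BalabanUVNodesN05SubBKnit.exists_c₁_b8LeafRS_subB_cut_of_knit_lettersRDU(B)` ∕ `…N05SubBKnitZdLan.exists_c₁_b8LeafRS_subB_cut_zdLan_of_knit_lettersRDUB` at their `c₁`.
[cite: Balaban1985RegularSpaces, Lemma 1 – Thm 8 pp.79–101 (bookkeeping)] -/
theorem b8LeafOfRecordSubB_cutSubB_iff (lam : ResidB8 θ) (J : Type) (lan : J → B8.LandauData) (c₁ : ℝ) :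
    B8LeafOfRecordSubB θ (lam.cutSubB J lan c₁) ↔
      B8LeafRS θ.D (θ.L : ℝ) lam.C₂ lam.B₁' lam.inp.B₀' lam.B₁ lam.B₂ c₁ lam.inp lam.B₀β (blockPairNA θ.D θ.L θ.𝔸)
        (fun j : IdxB8SubB θ => famB8OfRecordSubB θ lam.β lam.len j) lan (fun j : IdxB8SubB θ => cubB8OfRecord θ j.1) (fun j => lam.toAxial j.1) :=
  Iff.rfl

/-- Non-vacuity of the cut layer's two located indices: the four-law sub-index is inhabited (`nonempty_idxB8SubB`), so neither the family binder nor the Prop.-6 slot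
ranges over an empty type. [cite: Balaban1985RegularSpaces, p.77, Prop. 6 p.99 (bookkeeping)] -/
theorem ResidB8.nonempty_cutSubB_I8d (lam : ResidB8 θ) (J : Type) (lan : J → B8.LandauData) (c₁ : ℝ) : Nonempty (lam.cutSubB J lan c₁).I8d :=
  B8IdxB8LawsB.nonempty_idxB8SubB θ

end CutLayer

end Literature.MathematicalPhysics.QuantumFieldTheory.Balaban1983to89.Node00

end
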